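import Literature.AnabelianGeometry.SemiGraphs.FiniteCoveringsGalois
import Literature.AnabelianGeometry.SemiGraphs.PiPresentationBridge
import Literature.AnabelianGeometry.SemiGraphs.TemperedVerticialInjective
import Literature.AnabelianGeometry.SemiGraphs.OrbitGraph
import Mathlib.CategoryTheory.Galois.Decomposition
import HarnessLib

/-!
# [SemiAnbd] Prop. 3.6 (iii), rung 1: the Galois approximation property `GaloisApprox` — PROVED

Mochizuki, *Semi-graphs of anabelioids*, Publ. RIMS **42** (2006), §3, proof of Prop. 3.6 p. 38
[cite: MochizukiSemiAnbd2006, Prop 3.6 p.38]: "consider the projective system of connected finite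
étale Galois coverings `𝒢_i → 𝒢`" — every finite étale covering of a connected semi-graph of
anabelioids is dominated by a connected finite étale GALOIS covering whose automorphisms act
transitively on every fibre.  This is the input `GaloisApprox 𝒢` of abc-iut-L3-d5's assembly
`temperedPiResiduallyFinite_of_galoisApprox` (sub-DAG of `SemiAnbd:Prop3.6(iii)`, seat w4-d098).
Proof (Galois-category theory only): `B(𝒢)` is Galois with a fibre functor through EVERY vertex
and edge (`galoisCategory_bObj`, `fiberFunctor_ρ(E)`, `fiberFunctor_forget_bCat`); a finite
covering is represented by a Galois object `A` (Mathlib `exists_galois_representative`); `A`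
dominates every point over every vertex/edge (`exists_hom_apply_eq_of_surjective_eval`); `Aut A`
is transitive on every fibre (`isPretransitive_of_isGalois`); hence `A` SPLITS the covering and has
one component (the sub-covering on a component is a non-initial subobject of the connected `A`).
PROOF-ONLY file (no definitions; the forgetful basepoints are written out as functor expressions).
Nothing here bears on [IUTchIII] Cor. 3.12.
-/

namespace Literature.AnabelianGeometry.SemiGraphs

open CategoryTheory CategoryTheory.Limits CategoryTheory.PreGaloisCategory
open Literature.AnabelianGeometry.Anabelioids

universe w u

/-! ### 1. Galois categories: a representing Galois object dominates every fibre functor -/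

section Galois

variable {C : Type*} [Category C] [GaloisCategory C]

/-- In a Galois category, if `A` is connected and every point of `F₀(X)` is `F₀(f)(a)` for some
`f : A ⟶ X` (e.g. a Galois representative, Mathlib `exists_galois_representative`), then for ANY
fibre functor `F` every point of `F(X)` is `F(f)(a')` for some `f : A ⟶ X`: the point lies in a
connected component `i : Y ↪ X`, an arrow `A ⟶ X` meeting `Y` factors through `i` (pull back the
mono `i` to the connected `A`), and `A ⟶ Y` is surjective on `F`-fibres. [folklore] -/
private theorem exists_hom_apply_eq_of_surjective_eval (F₀ F : C ⥤ FintypeCat.{w}) [FiberFunctor F₀]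
    [FiberFunctor F] {A X : C} [IsConnected A] (a : F₀.obj A)
    (hA : Function.Surjective fun f : A ⟶ X => F₀.map f a) (x : F.obj X) :
    ∃ (f : A ⟶ X) (a' : F.obj A), F.map f a' = x := by
  obtain ⟨Y, i, y, hy, hY, hi⟩ := fiber_in_connected_component F X x
  obtain ⟨y₀⟩ := (inferInstance : Nonempty (F₀.obj Y))
  obtain ⟨f, hf⟩ := hA (F₀.map i y₀)
  -- factor `f` through `i`: the pull-back of `i` along `f` is a non-initial subobject of `A`
  have hP : IsInitial (pullback f i) → False := fun hin =>
    not_initial_of_inhabited F₀ ((fiberPullbackEquiv F₀ f i).symm ⟨(a, y₀), hf⟩) hin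
  haveI : IsIso (pullback.fst f i) := IsConnected.noTrivialComponent _ (pullback.fst f i) hP
  let g : A ⟶ Y := inv (pullback.fst f i) ≫ pullback.snd f i
  have hg : g ≫ i = f := by
    simp only [g, Category.assoc, ← pullback.condition, IsIso.inv_hom_id_assoc]
  obtain ⟨a', ha'⟩ := surjective_of_nonempty_fiber_of_isConnected F g y
  refine ⟨f, a', ?_⟩
  rw [← hg, F.map_comp, FintypeCat.comp_apply, ha', hy]

end Galois

/-! ### 2. `B(𝒢)`: the forgetful basepoints through every vertex and every edge -/

namespace ProfiniteSemiGraph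

open scoped FintypeCatDiscrete

variable (𝒢 : ProfiniteSemiGraph.{u})

/-- For connected `𝒢`, `S ↦ S_v` (underlying finite set) is a fibre functor of `B(𝒢)` ("natural
outer homomorphisms `Π_v → Π_𝒢`", [SemiAnbd] p. 23). [cite: MochizukiSemiAnbd2006, Def. 2.1 p.23] -/
theorem fiberFunctor_ρ_forget (hc : 𝒢.graph.IsConnected) (v : 𝒢.graph.Vertex) :
    letI := 𝒢.toAnab.preGaloisCategory_bObj
    FiberFunctor (𝒢.toAnab.ρ v ⋙
      (ObjectProperty.ι (Action.IsContinuous (V := FintypeCat.{u}) (G := 𝒢.Gv v)) ⋙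
        Action.forget FintypeCat.{u} (𝒢.Gv v))) := by
  haveI : @FiberFunctor (𝒢.toAnab.V v) (𝒢.toAnab.catV v) (𝒢.toAnab.galV v).toPreGaloisCategory
      (ObjectProperty.ι (Action.IsContinuous (V := FintypeCat.{u}) (G := 𝒢.Gv v)) ⋙
        Action.forget FintypeCat.{u} (𝒢.Gv v)) := fiberFunctor_forget_bCat (𝒢.Gv v)
  exact 𝒢.toAnab.fiberFunctor_ρ ⟨hc⟩ v _

/-- For connected `𝒢`, `S ↦ S_e` is a fibre functor of `B(𝒢)`.
[cite: MochizukiSemiAnbd2006, Def. 2.1 p.23] -/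
theorem fiberFunctor_ρE_forget (hc : 𝒢.graph.IsConnected) (e : 𝒢.graph.Edge) :
    letI := 𝒢.toAnab.preGaloisCategory_bObj
    FiberFunctor (𝒢.toAnab.ρE e ⋙
      (ObjectProperty.ι (Action.IsContinuous (V := FintypeCat.{u}) (G := 𝒢.Ge e)) ⋙
        Action.forget FintypeCat.{u} (𝒢.Ge e))) := by
  haveI : @FiberFunctor (𝒢.toAnab.E e) (𝒢.toAnab.catE e) (𝒢.toAnab.galE e).toPreGaloisCategory
      (ObjectProperty.ι (Action.IsContinuous (V := FintypeCat.{u}) (G := 𝒢.Ge e)) ⋙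
        Action.forget FintypeCat.{u} (𝒢.Ge e)) := fiberFunctor_forget_bCat (𝒢.Ge e)
  exact 𝒢.toAnab.fiberFunctor_ρE ⟨hc⟩ e _

variable {𝒢}

/-! ### 3. A Galois finite étale covering: transitive endomorphisms, splitting -/

/-- For a Galois object `A` of `B(𝒢)` (connected `𝒢`), the endomorphisms of the underlying covering
act transitively on every vertex fibre. [cite: MochizukiSemiAnbd2006, Prop 3.6 p.38] -/
theorem exists_endo_apply_eq_of_isGalois (hc : 𝒢.graph.IsConnected) (A : 𝒢.toAnab.BObj)
    (hA : letI := 𝒢.toAnab.galoisCategory_bObj ⟨hc⟩; IsGalois A)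
    (v : 𝒢.graph.Vertex) (x x' : ((𝒢.ofBObj.obj A).SV v).obj.V) :
    ∃ σ : 𝒢.ofBObj.obj A ⟶ 𝒢.ofBObj.obj A, (σ.fV v).hom.hom x = x' := by
  letI := 𝒢.toAnab.galoisCategory_bObj ⟨hc⟩
  let Φ : 𝒢.toAnab.BObj ⥤ FintypeCat.{u} := 𝒢.toAnab.ρ v ⋙
    (ObjectProperty.ι (Action.IsContinuous (V := FintypeCat.{u}) (G := 𝒢.Gv v)) ⋙
      Action.forget FintypeCat.{u} (𝒢.Gv v))
  haveI : FiberFunctor Φ := 𝒢.fiberFunctor_ρ_forget hc v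
  haveI := hA
  obtain ⟨σ, hσ⟩ := MulAction.exists_smul_eq (Aut A) (α := Φ.obj A) x x'
  exact ⟨𝒢.ofBObj.map σ.hom, hσ⟩

/-- The stabiliser argument ([SemiAnbd] Def. 3.5 (ii) "splits"): if the Galois object `A` represents
the basepoint through `v₀` on `X`, the covering underlying `A` SPLITS the one underlying `X`: a
point `s` of `X` is `f(a')` (domination), `a' = τ x` for any point `x` of `A` over the same
component (transitivity), and `f`, `τ` are equivariant.
[cite: MochizukiSemiAnbd2006, Def 3.5(ii) p.37] -/
theorem ofBObj_splits_of_representative (hc : 𝒢.graph.IsConnected) (v₀ : 𝒢.graph.Vertex)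
    (A X : 𝒢.toAnab.BObj) (hA : letI := 𝒢.toAnab.galoisCategory_bObj ⟨hc⟩; IsGalois A)
    (a : ((𝒢.ofBObj.obj A).SV v₀).obj.V)
    (hsurj : Function.Surjective fun f : A ⟶ X => ((𝒢.ofBObj.map f).fV v₀).hom.hom a) :
    (𝒢.ofBObj.obj A).Splits (𝒢.ofBObj.obj X) := by
  letI := 𝒢.toAnab.galoisCategory_bObj ⟨hc⟩
  haveI := hA
  let Φ₀ : 𝒢.toAnab.BObj ⥤ FintypeCat.{u} := 𝒢.toAnab.ρ v₀ ⋙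
    (ObjectProperty.ι (Action.IsContinuous (V := FintypeCat.{u}) (G := 𝒢.Gv v₀)) ⋙
      Action.forget FintypeCat.{u} (𝒢.Gv v₀))
  haveI : FiberFunctor Φ₀ := 𝒢.fiberFunctor_ρ_forget hc v₀
  have hsurj' : Function.Surjective fun f : A ⟶ X => Φ₀.map f a := hsurj
  refine ⟨fun v x g hgx s => ?_, fun e x g hgx s => ?_⟩
  · let Φ : 𝒢.toAnab.BObj ⥤ FintypeCat.{u} := 𝒢.toAnab.ρ v ⋙
      (ObjectProperty.ι (Action.IsContinuous (V := FintypeCat.{u}) (G := 𝒢.Gv v)) ⋙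
        Action.forget FintypeCat.{u} (𝒢.Gv v))
    haveI : FiberFunctor Φ := 𝒢.fiberFunctor_ρ_forget hc v
    obtain ⟨f, a', hfa⟩ := exists_hom_apply_eq_of_surjective_eval Φ₀ Φ a hsurj' (s : Φ.obj X)
    obtain ⟨τ, hτ⟩ := MulAction.exists_smul_eq (Aut A) (α := Φ.obj A) x a'
    -- `g` fixes `a' = τ x` (equivariance of `τ`)
    have hτ' : ((𝒢.ofBObj.map τ.hom).fV v).hom.hom x = a' := hτ
    have hτx : ((𝒢.ofBObj.map τ.hom).fV v).hom.hom (((𝒢.ofBObj.obj A).SV v).obj.ρ g x) =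
        ((𝒢.ofBObj.obj A).SV v).obj.ρ g (((𝒢.ofBObj.map τ.hom).fV v).hom.hom x) :=
      ConcreteCategory.congr_hom (((𝒢.ofBObj.map τ.hom).fV v).hom.comm g) x
    have hga' : ((𝒢.ofBObj.obj A).SV v).obj.ρ g a' = a' := by
      rw [← hτ', ← hτx, hgx]
    -- hence `g` fixes `s = f a'` (equivariance of `f`)
    have hfa' : ((𝒢.ofBObj.map f).fV v).hom.hom a' = s := hfa
    have hfx : ((𝒢.ofBObj.map f).fV v).hom.hom (((𝒢.ofBObj.obj A).SV v).obj.ρ g a') =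
        ((𝒢.ofBObj.obj X).SV v).obj.ρ g (((𝒢.ofBObj.map f).fV v).hom.hom a') :=
      ConcreteCategory.congr_hom (((𝒢.ofBObj.map f).fV v).hom.comm g) a'
    rw [← hfa', ← hfx, hga']
  · let Φ : 𝒢.toAnab.BObj ⥤ FintypeCat.{u} := 𝒢.toAnab.ρE e ⋙
      (ObjectProperty.ι (Action.IsContinuous (V := FintypeCat.{u}) (G := 𝒢.Ge e)) ⋙
        Action.forget FintypeCat.{u} (𝒢.Ge e))
    haveI : FiberFunctor Φ := 𝒢.fiberFunctor_ρE_forget hc e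
    obtain ⟨f, a', hfa⟩ := exists_hom_apply_eq_of_surjective_eval Φ₀ Φ a hsurj' (s : Φ.obj X)
    obtain ⟨τ, hτ⟩ := MulAction.exists_smul_eq (Aut A) (α := Φ.obj A) x a'
    have hτ' : ((𝒢.ofBObj.map τ.hom).fE e).hom.hom x = a' := hτ
    have hτx : ((𝒢.ofBObj.map τ.hom).fE e).hom.hom (((𝒢.ofBObj.obj A).SE e).obj.ρ g x) =
        ((𝒢.ofBObj.obj A).SE e).obj.ρ g (((𝒢.ofBObj.map τ.hom).fE e).hom.hom x) :=
      ConcreteCategory.congr_hom (((𝒢.ofBObj.map τ.hom).fE e).hom.comm g) x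
    have hga' : ((𝒢.ofBObj.obj A).SE e).obj.ρ g a' = a' := by
      rw [← hτ', ← hτx, hgx]
    have hfa' : ((𝒢.ofBObj.map f).fE e).hom.hom a' = s := hfa
    have hfx : ((𝒢.ofBObj.map f).fE e).hom.hom (((𝒢.ofBObj.obj A).SE e).obj.ρ g a') =
        ((𝒢.ofBObj.obj X).SE e).obj.ρ g (((𝒢.ofBObj.map f).fE e).hom.hom a') :=
      ConcreteCategory.congr_hom (((𝒢.ofBObj.map f).fE e).hom.comm g) a'
    rw [← hfa', ← hfx, hga']

/-! ### 4. The sub-covering on an adjacency-closed set of points; connected ⇒ one component -/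

/-- `glue⁻¹ (glue y) = y` on points. [cite: MochizukiSemiAnbd2006, Def 3.5(i) p.37] -/
private theorem CovObj.glue_inv_hom_pt (S : CovObj 𝒢) (b : 𝒢.graph.Branch) (v : 𝒢.graph.Vertex)
    (h : 𝒢.graph.abuts b = some v) (y : (S.SE (𝒢.graph.edgeOf b)).obj.V) :
    (S.glue b v h).inv.hom.hom ((S.glue b v h).hom.hom.hom y) = y :=
  ConcreteCategory.congr_hom (congrArg
    (fun φ : S.SE (𝒢.graph.edgeOf b) ⟶ S.SE (𝒢.graph.edgeOf b) => φ.hom.hom)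
    (S.glue b v h).hom_inv_id) y

/-- `glue (glue⁻¹ x) = x` on points. [cite: MochizukiSemiAnbd2006, Def 3.5(i) p.37] -/
private theorem CovObj.glue_hom_inv_pt (S : CovObj 𝒢) (b : 𝒢.graph.Branch) (v : 𝒢.graph.Vertex)
    (h : 𝒢.graph.abuts b = some v) (x : (S.SV v).obj.V) :
    (S.glue b v h).hom.hom.hom ((S.glue b v h).inv.hom.hom x) = x :=
  ConcreteCategory.congr_hom (congrArg
    (fun φ : (BTemp.res (𝒢.brHom b v h)).obj (S.SV v) ⟶ (BTemp.res (𝒢.brHom b v h)).obj (S.SV v) =>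
      φ.hom.hom) (S.glue b v h).inv_hom_id) x

/-- **The sub-covering on an adjacency-closed set of points** ([SemiAnbd] Def. 3.5 (ii): a union of
connected components of a covering is a covering): for `K ⊆ S.Point` closed under adjacency there
are an object `R` of `B^cov(𝒢)` (constructed in the proof: fibres the subtypes cut out by `K`) and
a MONOMORPHISM `ι : R ⟶ S` whose image on every fibre is exactly `K`; `R` is finite if `S` is.
[cite: MochizukiSemiAnbd2006, Def 3.5(ii) p.37] -/
theorem CovObj.exists_subcovering (S : CovObj 𝒢) (K : S.Point → Prop)
    (hK : ∀ p q, S.Adj p q → (K p ↔ K q)) :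
    ∃ (R : CovObj 𝒢) (ι : R ⟶ S), Mono ι ∧ (S.IsFinite → R.IsFinite) ∧
      (∀ (v : 𝒢.graph.Vertex) (x : (R.SV v).obj.V), K (Sum.inl ⟨v, (ι.fV v).hom.hom x⟩)) ∧
      (∀ (e : 𝒢.graph.Edge) (y : (R.SE e).obj.V), K (Sum.inr ⟨e, (ι.fE e).hom.hom y⟩)) ∧
      (∀ (v : 𝒢.graph.Vertex) (x : (S.SV v).obj.V), K (Sum.inl ⟨v, x⟩) →
        ∃ x' : (R.SV v).obj.V, (ι.fV v).hom.hom x' = x) ∧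
      (∀ (e : 𝒢.graph.Edge) (y : (S.SE e).obj.V), K (Sum.inr ⟨e, y⟩) →
        ∃ y' : (R.SE e).obj.V, (ι.fE e).hom.hom y' = y) := by
  -- the restricted actions
  let RV : ∀ v : 𝒢.graph.Vertex, Action (Type u) (𝒢.Gv v) := fun v =>
    { V := {x : (S.SV v).obj.V // K (Sum.inl ⟨v, x⟩)}
      ρ :=
        { toFun := fun g => TypeCat.ofHom fun x =>
            ⟨(S.SV v).obj.ρ g x.1, (hK _ _ (CovObj.Adj.vertex v g x.1)).mp x.2⟩
          map_one' := ConcreteCategory.hom_ext _ _ fun x => Subtype.ext (by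
            change ((S.SV v).obj.ρ 1) x.1 = x.1; rw [map_one]; rfl)
          map_mul' := fun g g' => ConcreteCategory.hom_ext _ _ fun x => Subtype.ext (by
            change ((S.SV v).obj.ρ (g * g')) x.1 = (S.SV v).obj.ρ g ((S.SV v).obj.ρ g' x.1)
            rw [map_mul]; rfl) } }
  let RE : ∀ e : 𝒢.graph.Edge, Action (Type u) (𝒢.Ge e) := fun e =>
    { V := {y : (S.SE e).obj.V // K (Sum.inr ⟨e, y⟩)}
      ρ :=
        { toFun := fun g => TypeCat.ofHom fun y =>
            ⟨(S.SE e).obj.ρ g y.1, (hK _ _ (CovObj.Adj.edge e g y.1)).mp y.2⟩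
          map_one' := ConcreteCategory.hom_ext _ _ fun y => Subtype.ext (by
            change ((S.SE e).obj.ρ 1) y.1 = y.1; rw [map_one]; rfl)
          map_mul' := fun g g' => ConcreteCategory.hom_ext _ _ fun y => Subtype.ext (by
            change ((S.SE e).obj.ρ (g * g')) y.1 = (S.SE e).obj.ρ g ((S.SE e).obj.ρ g' y.1)
            rw [map_mul]; rfl) } }
  -- they are objects of `B^temp` (countable, open stabilisers)
  have hRV : ∀ v, temperedAction (𝒢.Gv v) (RV v) := fun v => by
    haveI : Countable (S.SV v).obj.V := (S.SV v).property.1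
    refine ⟨inferInstanceAs (Countable {x : (S.SV v).obj.V // K (Sum.inl ⟨v, x⟩)}), fun x => ?_⟩
    have h : {g : 𝒢.Gv v | (RV v).ρ g x = x} = {g : 𝒢.Gv v | (S.SV v).obj.ρ g x.1 = x.1} :=
      Set.ext fun g => ⟨fun h => congrArg Subtype.val h, fun h => Subtype.ext h⟩
    rw [h]
    exact (S.SV v).property.2 x.1
  have hRE : ∀ e, temperedAction (𝒢.Ge e) (RE e) := fun e => by
    haveI : Countable (S.SE e).obj.V := (S.SE e).property.1
    refine ⟨inferInstanceAs (Countable {y : (S.SE e).obj.V // K (Sum.inr ⟨e, y⟩)}), fun y => ?_⟩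
    have h : {g : 𝒢.Ge e | (RE e).ρ g y = y} = {g : 𝒢.Ge e | (S.SE e).obj.ρ g y.1 = y.1} :=
      Set.ext fun g => ⟨fun h => congrArg Subtype.val h, fun h => Subtype.ext h⟩
    rw [h]
    exact (S.SE e).property.2 y.1
  -- the restricted gluings
  let glueEquiv : ∀ (b : 𝒢.graph.Branch) (v : 𝒢.graph.Vertex) (h : 𝒢.graph.abuts b = some v),
      {y : (S.SE (𝒢.graph.edgeOf b)).obj.V // K (Sum.inr ⟨_, y⟩)} ≃
        {x : (S.SV v).obj.V // K (Sum.inl ⟨v, x⟩)} := fun b v h =>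
    { toFun := fun y =>
        ⟨(S.glue b v h).hom.hom.hom y.1, (hK _ _ (CovObj.Adj.glue b v h y.1)).mp y.2⟩
      invFun := fun x => ⟨(S.glue b v h).inv.hom.hom x.1, by
        have := (hK _ _ (CovObj.Adj.glue b v h ((S.glue b v h).inv.hom.hom x.1))).mpr
        rw [CovObj.glue_hom_inv_pt] at this
        exact this x.2⟩
      left_inv := fun y => Subtype.ext (S.glue_inv_hom_pt b v h y.1)
      right_inv := fun x => Subtype.ext (S.glue_hom_inv_pt b v h x.1) }
  let R : CovObj 𝒢 :=
    { SV := fun v => ⟨RV v, hRV v⟩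
      SE := fun e => ⟨RE e, hRE e⟩
      glue := fun b v h => BTemp.isoOfEquiv (glueEquiv b v h) fun g y =>
        Subtype.ext (S.glue_ρ b v h g y.1) }
  let ι : R ⟶ S :=
    { fV := fun v => ObjectProperty.homMk
        { hom := TypeCat.ofHom fun x : {x : (S.SV v).obj.V // K (Sum.inl ⟨v, x⟩)} => x.1
          comm := fun _ => rfl }
      fE := fun e => ObjectProperty.homMk
        { hom := TypeCat.ofHom fun y : {y : (S.SE e).obj.V // K (Sum.inr ⟨e, y⟩)} => y.1
          comm := fun _ => rfl }
      comm := fun b v h => ObjectProperty.hom_ext _ (Action.Hom.ext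
        (ConcreteCategory.hom_ext _ _ fun y => rfl)) }
  refine ⟨R, ι, ⟨fun {Z} f g hfg => ?_⟩, fun hS => ?_, fun v x => x.2, fun e y => y.2,
    fun v x hx => ⟨⟨x, hx⟩, rfl⟩, fun e y hy => ⟨⟨y, hy⟩, rfl⟩⟩
  · -- `ι` is a monomorphism: injective on every fibre
    refine CovHom.ext (funext fun v => ?_) (funext fun e => ?_)
    · exact ObjectProperty.hom_ext _ (Action.Hom.ext (ConcreteCategory.hom_ext _ _ fun z =>
        Subtype.ext (congrArg (fun φ => (CovHom.fV φ v).hom.hom z) hfg)))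
    · exact ObjectProperty.hom_ext _ (Action.Hom.ext (ConcreteCategory.hom_ext _ _ fun z =>
        Subtype.ext (congrArg (fun φ => (CovHom.fE φ e).hom.hom z) hfg)))
  · haveI := hS.finite_V
    haveI := hS.finite_E
    exact ⟨fun v => inferInstanceAs (Finite {x : (S.SV v).obj.V // K (Sum.inl ⟨v, x⟩)}),
      fun e => inferInstanceAs (Finite {y : (S.SE e).obj.V // K (Sum.inr ⟨e, y⟩)})⟩

/-- An isomorphism of `B^cov(𝒢)` is surjective on every vertex fibre.
[cite: MochizukiSemiAnbd2006, §3 p.36] -/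
theorem CovHom.surjective_fV_of_isIso {S T : CovObj 𝒢} (f : S ⟶ T) [IsIso f]
    (v : 𝒢.graph.Vertex) : Function.Surjective (f.fV v).hom.hom := by
  haveI : IsIso (f.fV v) := (inferInstance : IsIso ((restrictV 𝒢 v).map f))
  exact (((temperedAction (𝒢.Gv v)).ι ⋙ Action.forget (Type u) (𝒢.Gv v)).mapIso
    (asIso (f.fV v))).toEquiv.surjective

/-- An isomorphism of `B^cov(𝒢)` is surjective on every edge fibre.
[cite: MochizukiSemiAnbd2006, §3 p.36] -/
theorem CovHom.surjective_fE_of_isIso {S T : CovObj 𝒢} (f : S ⟶ T) [IsIso f]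
    (e : 𝒢.graph.Edge) : Function.Surjective (f.fE e).hom.hom := by
  haveI : IsIso (f.fE e) := (inferInstance : IsIso ((restrictE 𝒢 e).map f))
  exact (((temperedAction (𝒢.Ge e)).ι ⋙ Action.forget (Type u) (𝒢.Ge e)).mapIso
    (asIso (f.fE e))).toEquiv.surjective

/-- **A connected finite étale covering has one connected component** ([SemiAnbd] Def. 3.5 (ii)):
the sub-covering on a component, transported to `B(𝒢)`, is a non-initial subobject of the connected
`A`, hence all of `A`. [cite: MochizukiSemiAnbd2006, Def 3.5(ii) p.37] -/
theorem sameComponent_ofBObj_of_isConnected (hc : 𝒢.graph.IsConnected) (A : 𝒢.toAnab.BObj)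
    (hA : letI := 𝒢.toAnab.galoisCategory_bObj ⟨hc⟩; PreGaloisCategory.IsConnected A)
    (p q : (𝒢.ofBObj.obj A).Point) : (𝒢.ofBObj.obj A).SameComponent p q := by
  letI := 𝒢.toAnab.galoisCategory_bObj ⟨hc⟩
  haveI := hA
  -- the component of `p` as a sub-covering, transported to `B(𝒢)`
  let S : CovObj 𝒢 := 𝒢.ofBObj.obj A
  let K : S.Point → Prop := S.SameComponent p
  have hK : ∀ x y, S.Adj x y → (K x ↔ K y) := fun x y hxy =>
    ⟨fun hx => Relation.EqvGen.trans _ _ _ hx (Relation.EqvGen.rel _ _ hxy), fun hy =>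
      Relation.EqvGen.trans _ _ _ hy (Relation.EqvGen.symm _ _ (Relation.EqvGen.rel _ _ hxy))⟩
  obtain ⟨R, ι, hmono, hfin, hKV, hKE, hsurjV, hsurjE⟩ := S.exists_subcovering K hK
  have hR : R.IsFinite := hfin (𝒢.ofBObj_isFinite A)
  let Y : 𝒢.toAnab.BObj := toBObjObj R hR
  let eY : 𝒢.ofBObj.obj Y ≅ R := ofBObjIso R hR
  let φ : 𝒢.ofBObj.obj Y ⟶ 𝒢.ofBObj.obj A := eY.hom ≫ ι
  let j : Y ⟶ A := 𝒢.ofBObj.preimage φ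
  have hj : 𝒢.ofBObj.map j = φ := 𝒢.ofBObj.map_preimage φ
  -- `j` is a monomorphism from a non-initial object into the connected `A`, hence an isomorphism
  haveI : Mono φ := mono_comp _ _
  haveI : Mono j := 𝒢.ofBObj.mono_of_mono_map (hj ▸ inferInstance)
  have hY : IsInitial Y → False := by
    intro hin
    rcases p with ⟨v, x⟩ | ⟨e, y⟩
    · haveI := 𝒢.fiberFunctor_ρ_forget hc v
      obtain ⟨x', -⟩ := hsurjV v x (Relation.EqvGen.refl _)
      exact not_initial_of_inhabited (𝒢.toAnab.ρ v ⋙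
        (ObjectProperty.ι (Action.IsContinuous (V := FintypeCat.{u}) (G := 𝒢.Gv v)) ⋙
          Action.forget FintypeCat.{u} (𝒢.Gv v))) (X := Y) x' hin
    · haveI := 𝒢.fiberFunctor_ρE_forget hc e
      obtain ⟨y', -⟩ := hsurjE e y (Relation.EqvGen.refl _)
      exact not_initial_of_inhabited (𝒢.toAnab.ρE e ⋙
        (ObjectProperty.ι (Action.IsContinuous (V := FintypeCat.{u}) (G := 𝒢.Ge e)) ⋙
          Action.forget FintypeCat.{u} (𝒢.Ge e))) (X := Y) y' hin
  haveI : IsIso j := PreGaloisCategory.IsConnected.noTrivialComponent Y j hY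
  haveI : IsIso φ := hj ▸ inferInstance
  haveI : IsIso ι := by
    have : ι = eY.inv ≫ φ := (Iso.inv_hom_id_assoc eY _).symm
    rw [this]
    infer_instance
  -- so every point of `A` lies in the component of `p`
  rcases q with ⟨v, x⟩ | ⟨e, y⟩
  · obtain ⟨x', hx'⟩ := CovHom.surjective_fV_of_isIso ι v x
    rw [← hx']
    exact hKV v x'
  · obtain ⟨y', hy'⟩ := CovHom.surjective_fE_of_isIso ι e y
    rw [← hy']
    exact hKE e y'

/-! ### 5. Assembly: the Galois approximation property -/

/-- **The Galois approximation property** ([SemiAnbd] proof of Prop. 3.6, p. 38: connected finite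
étale Galois coverings are cofinal): for connected `𝒢` with a vertex, every finite object `F` of
`B^cov(𝒢)` is SPLIT by a finite covering `A` with a point, one component and vertex-fibre-transitive
endomorphisms (the covering underlying a Galois object representing `F`).  The conclusion is the
body of abc-iut-L3-d5's `GaloisApprox 𝒢` verbatim. [cite: MochizukiSemiAnbd2006, Prop 3.6 p.38] -/
theorem galoisApprox_of_isConnected (hc : 𝒢.graph.IsConnected) (hv : 𝒢.HasVertex)
    (F : CovObj 𝒢) (hF : F.IsFinite) :
    ∃ A : CovObj 𝒢, A.IsFinite ∧ Nonempty A.Point ∧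
      (∀ p q : A.Point, A.SameComponent p q) ∧
      (∀ (v : 𝒢.graph.Vertex) (x x' : (A.SV v).obj.V), ∃ σ : A ⟶ A, (σ.fV v).hom.hom x = x') ∧
      A.Splits F := by
  obtain ⟨v₀⟩ := hv
  letI := 𝒢.toAnab.galoisCategory_bObj ⟨hc⟩
  let Φ₀ : 𝒢.toAnab.BObj ⥤ FintypeCat.{u} := 𝒢.toAnab.ρ v₀ ⋙
    (ObjectProperty.ι (Action.IsContinuous (V := FintypeCat.{u}) (G := 𝒢.Gv v₀)) ⋙
      Action.forget FintypeCat.{u} (𝒢.Gv v₀))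
  haveI : FiberFunctor Φ₀ := 𝒢.fiberFunctor_ρ_forget hc v₀
  -- the Galois object representing `F` (seen in `B(𝒢)`) at the basepoint through `v₀`
  let X : 𝒢.toAnab.BObj := toBObjObj F hF
  obtain ⟨A, a, hgal, hbij⟩ := exists_galois_representative Φ₀ X
  refine ⟨𝒢.ofBObj.obj A, 𝒢.ofBObj_isFinite A, ⟨Sum.inl ⟨v₀, a⟩⟩,
    sameComponent_ofBObj_of_isConnected hc A hgal.toIsConnected,
    fun v x x' => exists_endo_apply_eq_of_isGalois hc A hgal v x x', ?_⟩
  -- `A` splits the covering underlying `X`, which is `F` (same fibres, same actions)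
  have h := ofBObj_splits_of_representative hc v₀ A X hgal a hbij.2
  exact ⟨fun v x g hgx s => h.1 v x g hgx s, fun e x g hgx s => h.2 e x g hgx s⟩

/-- **`GaloisApprox 𝒢` under the hypotheses of [SemiAnbd] Prop. 3.6** (unfolded; the wrapper
`galoisApprox_of_prop36 : 𝒢.Prop36Hypotheses → GaloisApprox 𝒢` is `exact` this once
`TemperedResiduallyFiniteAssembly.lean` is in the tree).
[cite: MochizukiSemiAnbd2006, Prop 3.6 p.38] -/
theorem galoisApprox_of_prop36Hypotheses (h36 : 𝒢.Prop36Hypotheses) (F : CovObj 𝒢)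
    (hF : F.IsFinite) :
    ∃ A : CovObj 𝒢, A.IsFinite ∧ Nonempty A.Point ∧
      (∀ p q : A.Point, A.SameComponent p q) ∧
      (∀ (v : 𝒢.graph.Vertex) (x x' : (A.SV v).obj.V), ∃ σ : A ⟶ A, (σ.fV v).hom.hom x = x') ∧
      A.Splits F :=
  galoisApprox_of_isConnected h36.isConnected h36.hasVertex F hF

end ProfiniteSemiGraph

end Literature.AnabelianGeometry.SemiGraphs
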